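import Summits.HodgeConjecture.HodgeConjecture.Theorems.R90S6CartanShellSphere     -- ★ W7-i (A1 currency): `latticeGraphIso_apartmentEnum_zero_eq_latticeGraphIso_iff`, `exists_latticeGraphIso_apartmentEnum_zero_eq_iff`;
                                                                                   --   brings ★ `UnitaryLatticeTreeGeodesicApartment` (`exists_apartmentEnum`, `exists_eq_latticeGraphIso_apartmentEnum_neg_one`), ★ `UnitaryLatticeTreeStabilizer`
                                                                                   --   (`mapGL_latt_eq_latt_iff`), ★ `UnitaryLatticeTreeApartment` (`isVertexLattice_two_latt_diagonal_one_one`), `UnramifiedLocalConjDatum`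
import Summits.HodgeConjecture.HodgeConjecture.Theorems.R90S6GLCosetLatticeDict    -- ★ W7-f (i) `mem_glInt_iff_isIntMatrix` (`GL₃(𝒪)` in the lattice files' currency; brings ★ `ValuedFieldValuativeRelBridge`)
import HarnessLib

/-!
# R90 · S6 «Ch. 14.1–14.5 stable trace formula» — card DICT0 (GF1's missing letter (m1)): FIXED COSETS ↔ FIXED VERTICES, BY TYPE
# `#Fix_γ(U ⧸ K₀) = #{v hyperspecial : γ·v = v}` and `#Fix_γ(U ⧸ K₁) = #{v special : γ·v = v}` (`Theorems/R90S6FixedCosetsVertexDictionary.lean`)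

Cell `hodgecm-mathlib`, crux H413 (`stmt-HodgeConjecture-24833`), route of record `HCCMUnconditional`; programme R90-TF (brief `director/R90-BRIEF.v2.md`
1f40d54518340a35), section S6 (base `R90-C14`, dealer R90-C14-plan (g2)), seat R90-C14-p10 (g2); CARD DICT0 dealt BY NAME 2026-09-05T02:24:21Z (R90 bus).
Lane `--kind proof --supports stmt-HodgeConjecture-24833 --as helper`; THEOREMS ONLY (no definition, no instance, no notation, no named fact, no kit, no `sorry`);
imports = ★ W7-i `Theorems/R90S6CartanShellSphere` (R90-C14-p04's A1 currency) + ★ W7-f (i) `Theorems/R90S6GLCosetLatticeDict` + HarnessLib (Theorems → Theorems ∕ Literature;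
never `Lines/`).

CONSUMER BY NAME: K2Liu-p14 (g5)'s GF1 FILE 2 (row E1.3.5.2.6, the per-literal plug-in of the Fix data `V_hyp(tᵢ), V_sp(tᵢ)`): the ★ G1 rungs
(`R90S6TorusFixedSpecialCount*`, `R90S6TorusFixedCountsRegular`) COUNT the COSET types `Nat.card (fixedBy (U ⧸ K₀_U) γ)` ∕ `Nat.card (fixedBy (U ⧸ K₁_U) γ)`
(`K₀_U = (glInt 3 K).subgroupOf U`, `K₁_U = ((glInt 3 K).map (MulAut.conj g₁)).subgroupOf U`, `g₁ = diag(1, 1, ϖ)` — the binders of ★ G1 FILE 1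
`natCard_fixedBy_special_add_eq_one_add_sum`), while the TREE side (★ W8-f `R90S6TreeDisplacementSphereCount`, ★ G3-NUMBERS `R90S6GSideEllipticValueClosed`
`ncard_selfDual_displaced_zero_eq_ncard_fixed_three`) counts FIXED VERTICES `{v | latticeGraphIso γ v = v}` of the `U(2,1)` lattice tree by type.  This file is the
dictionary between the two, for both vertex types, in exactly those bytes.

THE MATHEMATICS (orbit–stabiliser; [Serre1980Trees] II.1.1, [BruhatTits1972] §10, [Kottwitz1986BaseChangeUnits] §3).  `U = U(σ, J₀)(K)` acts on the vertices of
the lattice tree `X₃` (★ `latticeGraphIso`); the hyperspecial (self-dual, type `0`) vertices form ONE orbit, that of the root `A 0 = 𝒪³`, with stabiliser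
`K₀_U = U ∩ GL₃(𝒪)` (★ W7-i `latticeGraphIso_apartmentEnum_zero_eq_latticeGraphIso_iff`, ★ `exists_latticeGraphIso_apartmentEnum_zero_eq_iff`); the special
(type `2`) vertices form ONE orbit, that of `A(−1) = latt diag(1, 1, ϖ) = g₁·𝒪³`, with stabiliser `K₁_U = U ∩ g₁ GL₃(𝒪) g₁⁻¹` (★ `exists_eq_latticeGraphIso_apartmentEnum_neg_one`,
★ `mapGL_latt_eq_latt_iff`).  An equivariant bijection `U ⧸ Stab(x) ≃ U·x` matches `γ`-fixed cosets with `γ`-fixed vertices: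
* §1 (D0.0) **`natCard_fixedBy_quotient_eq_ncard_range_fixed`** — GENERIC: for a group `G`, `H ≤ G`, `γ ∈ G`, an orbit map `φ : G → X` with `φ g = φ g′ ↔ gH = g′H` and
  `φ (γ g) = T (φ g)`: `Nat.card (fixedBy (G ⧸ H) γ) = #{y ∈ range φ : T y = y}` (pure group theory; `q ↦ φ q.out`).
* §2 (D0.1) **`natCard_fixedBy_quotient_glInt_eq_ncard_selfDual_fixed`** — HYPERSPECIAL: `Nat.card (fixedBy (U ⧸ K₀_U) γ) = #{v : IsSelfDualLattice v ∧ γ·v = v}`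
  (right side = ★ G3-NUMBERS `ncard_selfDual_displaced_zero_eq_ncard_fixed_three`'s right side, byte for byte).
* §2 (D0.2) **`natCard_fixedBy_quotient_conj_glInt_eq_ncard_typeTwo_fixed`** — SPECIAL: `Nat.card (fixedBy (U ⧸ K₁_U) γ) = #{v : IsVertexLattice … 2 v ∧ γ·v = v}`
  (`hg₁ : g₁ = diag(1, 1, ϖ)` as in ★ G1 FILE 1; «special» = type `2` = G3-NUMBERS' `c v = 1`, the complement of the self-dual type on `X₃` by ★
  `not_exists_latticeGraphIso_apartmentEnum_zero_eq_and_one_eq`).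
In substance the hyperspecial half is ★ Literature `UnitaryLatticeTree.ncard_fixedBy_quotient_sep_eq_ncard_selfDual_fixed_sep` (`P = Q = ⊤`, Submodule-set currency) and ★ A1∕J2
`ncard_quotient_shell_eq_ncard_selfDual_displaced` at `m = 0` (orbit currency); here both halves are stated in the `Nat.card (fixedBy …)` ∕ vertex-subtype bytes GF1 rewrites with.
HONEST LABEL: dictionary glue, count-neutral until GF1 FILE 2 ∕ the (E1)(E2) sheets consume it; proves no printed global statement, discharges no citation; HC_CM is proved only
modulo the 7 printed citations (2 remaining named inputs: hLiu418 = stmt-HodgeConjecture-24832, h413 = stmt-HodgeConjecture-24833) until rung 0 closes.  REL ≠ ★ ≠ BUILT.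

## References
* [Serre1980Trees] J.-P. Serre, *Trees* (1980): Ch. II §1.1 (vertices of the building as lattice classes; the stabiliser of `𝒪^N`; orbit–stabiliser).
* [BruhatTits1972] F. Bruhat, J. Tits, *Groupes réductifs sur un corps local I*, Publ. Math. IHÉS 41 (1972): §10 (the two vertex types of the `U(2,1)` tree and their
  stabilisers).
* [Kottwitz1986BaseChangeUnits] R. E. Kottwitz, *Base change for unit elements of Hecke algebras*, Compositio Math. 60 (1986): §3 (fixed points on the building ↔ fixed
  cosets).
* [Rogawski1990] J. D. Rogawski, *Automorphic Representations of Unitary Groups in Three Variables*, Ann. of Math. Stud. 123 (1990): §4.9 pp. 54–55 (orbital integrals of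
  `1_{K₀}`, `1_{K₁}` as fixed-point counts).
-/

set_option autoImplicit false
-- the mandated namespace repeats the single-problem summit's segment (`HodgeConjecture.HodgeConjecture`)
set_option linter.dupNamespace false

noncomputable section

open MulAction
open scoped Valued WithZero Matrix MatrixGroups
open Literature.NumberTheory.Automorphic Literature.NumberTheory.Automorphic.HermitianLattice Literature.NumberTheory.Automorphic.UnitaryLatticeTree
  Literature.NumberTheory.Automorphic.UnitaryGroup

namespace Summit.HodgeConjecture.HodgeConjecture.R90.S6

/-! ## §1 (D0.0) The generic orbit–stabiliser dictionary for fixed cosets -/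

section Generic

variable {G X : Type*} [Group G]

/-- **(D0.0) FIXED COSETS ↔ FIXED POINTS OF THE ORBIT** (orbit–stabiliser, equivariant form): let `H ≤ G`, `γ ∈ G`, and `φ : G → X` an «orbit map» with
`φ g = φ g′ ↔ gH = g′H` (well defined on `G ⧸ H` and injective there — `H` is the stabiliser of the base point) and `φ (γ g) = T (φ g)` for a self-map `T` of `X` (the
action of `γ`).  Then `q ↦ φ q.out` is a bijection from the `γ`-fixed cosets `Fix_γ(G ⧸ H)` onto the `T`-fixed points of the orbit `range φ`:
`Nat.card (fixedBy (G ⧸ H) γ) = #{y ∈ range φ : T y = y}` (`Set.ncard`; both sides `0` when infinite). [cite: Serre1980Trees, Ch. II §1.1] -/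
theorem natCard_fixedBy_quotient_eq_ncard_range_fixed (H : Subgroup G) (γ : G) (φ : G → X) (T : X → X)
    (hφ : ∀ g g' : G, φ g = φ g' ↔ (g : G ⧸ H) = g') (hT : ∀ g : G, φ (γ * g) = T (φ g)) :
    Nat.card (fixedBy (G ⧸ H) γ) = {y : X | y ∈ Set.range φ ∧ T y = y}.ncard := by
  classical
  -- a coset is `γ`-fixed iff the orbit point of (any of) its representatives is `T`-fixed
  have key : ∀ q : G ⧸ H, q ∈ fixedBy (G ⧸ H) γ ↔ T (φ q.out) = φ q.out := by
    intro q
    have hq : γ • q = ((γ * q.out : G) : G ⧸ H) := by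
      rw [← smul_eq_mul, MulAction.Quotient.coe_smul_out]
    rw [MulAction.mem_fixedBy, hq, ← hT, hφ, QuotientGroup.out_eq']
  rw [Nat.card_coe_set_eq]
  refine Set.ncard_congr (fun q _ => φ q.out) (fun q hq => ⟨⟨q.out, rfl⟩, (key q).1 hq⟩) (fun q q' _ _ h => ?_) (fun y hy => ?_)
  · -- injective: equal orbit points ⇒ equal cosets
    have h' := (hφ _ _).1 h
    rwa [QuotientGroup.out_eq', QuotientGroup.out_eq'] at h'
  · -- onto: a `T`-fixed orbit point `φ g` comes from the fixed coset `gH`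
    obtain ⟨⟨g, rfl⟩, hTy⟩ := hy
    have e : φ ((g : G ⧸ H).out) = φ g := (hφ _ _).2 (QuotientGroup.out_eq' _)
    refine ⟨(g : G ⧸ H), ?_, e⟩
    rw [key, e]
    exact hTy

end Generic

/-! ## §2 The `U(2,1)` lattice tree: hyperspecial cosets `U ⧸ K₀`, special cosets `U ⧸ K₁` -/

section Tree

variable {K : Type*} [Field K] [Valued K ℤᵐ⁰] [ValuativeRel K] [(Valued.v : Valuation K ℤᵐ⁰).Compatible] {σ : K →+* K} {ϖ : K}

omit [ValuativeRel K] [(Valued.v : Valuation K ℤᵐ⁰).Compatible] in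
/-- `U(σ, J₀)(K)` acts on the vertices through `u ↦ latticeGraphIso u`, multiplicatively: `(γ u)·v = γ·(u·v)` (`mapGL (γ u) M = γ·(u·M)`, ★ `mapGL_mul`; a private copy of
★ `latticeGraphIso_mul_apply` of `UnitaryLatticeTreeFixedChildCountTransportRamified`, kept local to spare that import). [cite: BruhatTits1972, §10] -/
private theorem latticeGraphIso_mul_apply' (γ u : ↥(unitaryGroupOfForm σ ((StdForm.antidiagonal 3).over K)))
    (v : {M : Submodule 𝒪[K] (Fin 3 → K) // IsVertex σ ϖ ((StdForm.antidiagonal 3).over K) M}) :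
    latticeGraphIso σ ϖ ((StdForm.antidiagonal 3).over K) (γ * u) v =
      latticeGraphIso σ ϖ ((StdForm.antidiagonal 3).over K) γ (latticeGraphIso σ ϖ ((StdForm.antidiagonal 3).over K) u v) := by
  apply Subtype.ext
  rw [latticeGraphIso_apply_val, latticeGraphIso_apply_val, latticeGraphIso_apply_val, Subgroup.coe_mul, mapGL_mul]

/-- **(D0.1) HYPERSPECIAL: `#Fix_γ(U ⧸ K₀) = #{v hyperspecial : γ·v = v}`.**  For an unramified local conjugation datum `(σ, ϖ)` and `γ ∈ U = U(σ, J₀)(K)`: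
`Nat.card (fixedBy (U ⧸ (GL₃(𝒪) ⊓ U)) γ) = #{v ∈ X₃ : v self-dual ∧ γ·v = v}` — the `γ`-fixed cosets of the hyperspecial subgroup `K₀_U = U ∩ GL₃(𝒪)` (the left side of
the ★ G1 rungs) are the `γ`-fixed HYPERSPECIAL VERTICES of the lattice tree (the right side of ★ G3-NUMBERS `ncard_selfDual_displaced_zero_eq_ncard_fixed_three`):
(D0.0) for the orbit map `u ↦ u·A 0` of the root (`A 0 = 𝒪³`; stabiliser `K₀`, ★ W7-i `latticeGraphIso_apartmentEnum_zero_eq_latticeGraphIso_iff`; orbit = the self-dual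
vertices, ★ W7-i `exists_latticeGraphIso_apartmentEnum_zero_eq_iff`; `K₀_U = unitaryInt σ J₀` entrywise, ★ `mem_glInt_iff_isIntMatrix` ∕ ★ `mem_unitaryInt_iff`).
[cite: Serre1980Trees, Ch. II §1.1] [cite: BruhatTits1972, §10] [cite: Kottwitz1986BaseChangeUnits, §3] [cite: Rogawski1990, §4.9 p. 54] -/
theorem natCard_fixedBy_quotient_glInt_eq_ncard_selfDual_fixed (hd : UnramifiedLocalConjDatum σ ϖ)
    (γ : ↥(unitaryGroupOfForm σ ((StdForm.antidiagonal 3).over K))) :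
    Nat.card (fixedBy (↥(unitaryGroupOfForm σ ((StdForm.antidiagonal 3).over K)) ⧸
        (glInt 3 K).subgroupOf (unitaryGroupOfForm σ ((StdForm.antidiagonal 3).over K))) γ) =
      {v : {M : Submodule 𝒪[K] (Fin 3 → K) // IsVertex σ ϖ ((StdForm.antidiagonal 3).over K) M} |
        IsSelfDualLattice σ ϖ ((StdForm.antidiagonal 3).over K) v.1 ∧
          latticeGraphIso σ ϖ ((StdForm.antidiagonal 3).over K) γ v = v}.ncard := by
  obtain ⟨A, hA0, hA1⟩ := exists_apartmentEnum hd
  -- `K₀_U = U ∩ GL₃(𝒪)` is the `unitaryInt` of the lattice files (entries of `g`, `g⁻¹` of valuation `≤ 1`)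
  have hK : (glInt 3 K).subgroupOf (unitaryGroupOfForm σ ((StdForm.antidiagonal 3).over K)) = unitaryInt σ ((StdForm.antidiagonal 3).over K) := by
    ext g
    rw [Subgroup.mem_subgroupOf, mem_glInt_iff_isIntMatrix, mem_unitaryInt_iff]
    rfl
  rw [hK, natCard_fixedBy_quotient_eq_ncard_range_fixed (unitaryInt σ ((StdForm.antidiagonal 3).over K)) γ
    (fun u => latticeGraphIso σ ϖ ((StdForm.antidiagonal 3).over K) u (A 0)) (latticeGraphIso σ ϖ ((StdForm.antidiagonal 3).over K) γ)
    (latticeGraphIso_apartmentEnum_zero_eq_latticeGraphIso_iff A hA0) (fun u => latticeGraphIso_mul_apply' γ u (A 0))]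
  congr 1
  ext v
  simp only [Set.mem_setOf_eq, Set.mem_range]
  rw [exists_latticeGraphIso_apartmentEnum_zero_eq_iff hd A hA0 v]

/-- **(D0.2) SPECIAL: `#Fix_γ(U ⧸ K₁) = #{v special : γ·v = v}`.**  For an unramified local conjugation datum `(σ, ϖ)`, `g₁ = diag(1, 1, ϖ)` and `γ ∈ U = U(σ, J₀)(K)`:
`Nat.card (fixedBy (U ⧸ (g₁ GL₃(𝒪) g₁⁻¹ ⊓ U)) γ) = #{v ∈ X₃ : v of type 2 ∧ γ·v = v}` — the `γ`-fixed cosets of `K₁_U = U ∩ g₁GL₃(𝒪)g₁⁻¹` (the `K₁` of the ★ G1 rungs, bytes of ★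
`natCard_fixedBy_special_add_eq_one_add_sum`) are the `γ`-fixed SPECIAL (type-`2`) VERTICES: (D0.0) for the orbit map `u ↦ u·A(−1)` of the special apartment vertex
`A(−1) = latt diag(1, 1, ϖ) = g₁·𝒪³` (stabiliser test ★ `mapGL_latt_eq_latt_iff` + ★ `mem_glInt_iff_isIntMatrix`; orbit = all type-`2` vertices, ★
`exists_eq_latticeGraphIso_apartmentEnum_neg_one` + ★ `isVertexLattice_mapGL_iff`).  On `X₃` «type 2» = «not self-dual» (★ `not_exists_latticeGraphIso_apartmentEnum_zero_eq_and_one_eq`).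
[cite: Serre1980Trees, Ch. II §1.1] [cite: BruhatTits1972, §10] [cite: Kottwitz1986BaseChangeUnits, §3] [cite: Rogawski1990, §4.9 pp. 54–55] -/
theorem natCard_fixedBy_quotient_conj_glInt_eq_ncard_typeTwo_fixed (hd : UnramifiedLocalConjDatum σ ϖ)
    (g₁ : GL (Fin 3) K) (hg₁ : (g₁ : Matrix (Fin 3) (Fin 3) K) = Matrix.diagonal ![(1 : K), 1, ϖ])
    (γ : ↥(unitaryGroupOfForm σ ((StdForm.antidiagonal 3).over K))) :
    Nat.card (fixedBy (↥(unitaryGroupOfForm σ ((StdForm.antidiagonal 3).over K)) ⧸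
        ((glInt 3 K).map (MulAut.conj g₁).toMonoidHom).subgroupOf (unitaryGroupOfForm σ ((StdForm.antidiagonal 3).over K))) γ) =
      {v : {M : Submodule 𝒪[K] (Fin 3 → K) // IsVertex σ ϖ ((StdForm.antidiagonal 3).over K) M} |
        IsVertexLattice σ ϖ ((StdForm.antidiagonal 3).over K) 2 v.1 ∧
          latticeGraphIso σ ϖ ((StdForm.antidiagonal 3).over K) γ v = v}.ncard := by
  obtain ⟨A, hA0, hA1⟩ := exists_apartmentEnum hd
  -- the special base vertex `A(−1) = latt diag(1, 1, ϖ) = g₁·𝒪³`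
  have hAneg : (A (-1)).1 = latt ((g₁ : GL (Fin 3) K) : Matrix (Fin 3) (Fin 3) K) := by
    have h := hA1 (-1)
    rw [show (2 * (-1) + 1 : ℤ) = -1 by norm_num] at h
    rw [h, hg₁]
    congr 1
    funext i
    fin_cases i <;> simp
  have htwo : IsVertexLattice σ ϖ ((StdForm.antidiagonal 3).over K) 2 (A (-1)).1 := by
    rw [hAneg, hg₁]
    exact isVertexLattice_two_latt_diagonal_one_one hd.σϖ (v_le_one_of_v_eq_exp_neg_one hd.vϖ) (CartanUnique.uniformizer_ne_zero hd.vϖ)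
  -- orbit map of `A(−1)`: stabiliser `K₁_U`
  have hφ : ∀ u u' : ↥(unitaryGroupOfForm σ ((StdForm.antidiagonal 3).over K)),
      latticeGraphIso σ ϖ ((StdForm.antidiagonal 3).over K) u (A (-1)) = latticeGraphIso σ ϖ ((StdForm.antidiagonal 3).over K) u' (A (-1)) ↔
        ((u : ↥(unitaryGroupOfForm σ ((StdForm.antidiagonal 3).over K)) ⧸
            ((glInt 3 K).map (MulAut.conj g₁).toMonoidHom).subgroupOf (unitaryGroupOfForm σ ((StdForm.antidiagonal 3).over K))) = u') := by
    intro u u'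
    -- `u·x₁ = u′·x₁ ↔ (u⁻¹u′)·x₁ = x₁`
    have h1 : latticeGraphIso σ ϖ ((StdForm.antidiagonal 3).over K) u (A (-1)) = latticeGraphIso σ ϖ ((StdForm.antidiagonal 3).over K) u' (A (-1)) ↔
        mapGL ((u⁻¹ * u' : ↥(unitaryGroupOfForm σ ((StdForm.antidiagonal 3).over K))) : GL (Fin 3) K) (A (-1)).1 = (A (-1)).1 := by
      rw [← Subtype.coe_inj, latticeGraphIso_apply_val, latticeGraphIso_apply_val, Subgroup.coe_mul, InvMemClass.coe_inv, mapGL_mul]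
      constructor
      · intro h
        rw [← h, ← mapGL_mul, inv_mul_cancel, mapGL_one]
      · intro h
        conv_lhs => rw [← h, ← mapGL_mul, mul_inv_cancel, mapGL_one]
    rw [h1, QuotientGroup.eq, Subgroup.mem_subgroupOf, Subgroup.mem_map_equiv, MulAut.conj_symm_apply, Subgroup.coe_mul, InvMemClass.coe_inv,
      hAneg, mapGL_latt_eq_latt_iff, mem_glInt_iff_isIntMatrix]
    have hinv : (g₁⁻¹ * (((u : ↥(unitaryGroupOfForm σ ((StdForm.antidiagonal 3).over K))) : GL (Fin 3) K)⁻¹ * u') * g₁)⁻¹ =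
        g₁⁻¹ * (((u : ↥(unitaryGroupOfForm σ ((StdForm.antidiagonal 3).over K))) : GL (Fin 3) K)⁻¹ * u')⁻¹ * g₁ := by
      group
    rw [hinv]
  rw [natCard_fixedBy_quotient_eq_ncard_range_fixed _ γ (fun u => latticeGraphIso σ ϖ ((StdForm.antidiagonal 3).over K) u (A (-1)))
    (latticeGraphIso σ ϖ ((StdForm.antidiagonal 3).over K) γ) hφ (fun u => latticeGraphIso_mul_apply' γ u (A (-1)))]
  congr 1
  ext v
  simp only [Set.mem_setOf_eq, Set.mem_range]
  refine and_congr_left fun _ => ⟨?_, fun hv => ?_⟩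
  · rintro ⟨u, rfl⟩
    rw [latticeGraphIso_apply_val, isVertexLattice_mapGL_iff]
    exact htwo
  · obtain ⟨u, hu⟩ := exists_eq_latticeGraphIso_apartmentEnum_neg_one hd A hA1 hv
    exact ⟨u, hu.symm⟩

end Tree

end Summit.HodgeConjecture.HodgeConjecture.R90.S6

end
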